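import Summits.Ventures.CertifiedManyBodySolver.Upper.IntervalReaderSourcedBoxDensity
import Summits.Ventures.CertifiedManyBodySolver.Upper.IntervalReaderClaimNode
import Summits.Ventures.CertifiedManyBodySolver.Upper.ProducersFrameSourcedBoxNode

/-!
# Ventures/CertifiedManyBodySolver — Upper/IntervalReaderSourcedClaimNode.lean: bytes ⇒ THE W5 SOURCED-BOX CLAIM NODE
(part 31 of the Theorem-H1′ package; parts 1–30: `IntervalReaderSchur` … `IntervalReaderClaimNodeRows`)

HONEST FRAMING: first certified bounds; not a superconductivity verdict; every number certified (two readers)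
or labelled float.  A sourced-Hamiltonian upper is a certified variational ENERGY CEILING for
`H − μN − h(Δ_d + Δ_d†)` on one finite box together with a density window of the SAME vector; it is never a sign
of order and never an order-parameter word (LADDER v1.17 (i)).  This file composes already-landed theorems; it
certifies no number and moves no row.

THE W5 TWIN OF PARTS 29–30.  Parts 22 / 23 end at the consumers' Rayleigh rows for the FORMAT-mpsgf1 witness
`ψ̃ = toSpinVec⁻¹ Ψ`, `Ψ k = mpsOpenVar (a·b) A l r (k ∘ e)`: the energy sentence (`sourcedBox_sentence_of_reader`
in Lieb's frame `W = partialParticleHole D↓`, `producersSourcedBox_sentence_of_reader` in the producers' frame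
`S′ = W · orbitalPhase g`) and the density window (`densityWindow_of_reader`, the transformed particle number as the
explicit on-site sum `ab·1 + Σ_x (n_{x↑} − n_{x↓})`).  The W5 rows of record state their CLAIM NODE one step
further (`Certificates/HubbardSquare_n7o8_sourced_openbox…`: `∃ ψ, HasParity _ ψ ∧ ⟨ψ,ψ⟩ = 1 ∧
Re⟨ψ, A_C(μ,h) ψ⟩ ≤ e·ab ∧ n_lo·ab ≤ Re⟨ψ, N ψ⟩ ≤ n_hi·ab`), through `Upper.sourcedBoxNode_of_transformedWitness`
(Lieb frame) / `Upper.sourcedBoxNode_of_gaugedShibaWitness'` (producers' frame), whose two remaining inputs are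
FORMAT-mpsgf1 §2 V1 (`IsNParticle Ñ ψ̃` — the certificate's bond-charge labels) and V3 (`⟨ψ̃,ψ̃⟩ > 0` — the reader's
`Nrm` window with the code's assertion `n_lo > 0`, `h1sweep.py` l.398, shared substrate of `l3core-sgf`).  Hence:

* `partialParticleHole_conjTranspose_conj_totalNumber` — Lieb's frame is the producers' frame at `g ≡ 1`
  (`orbitalPhase 1 = 1`): `Wᴴ N W = ab·1 + Σ_x (n_{x↑} − n_{x↓})`;
* `transformedWitness_sector_of_reader` — F-V2 labels with right label `Ñ` ⟹ `IsNParticle Ñ ψ̃`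
  (`JordanWigner.isNParticle_iff` + part 29's `mpsOpenVar_relabel_eq_zero_of_charge`);
* `transformedWitness_pos_of_reader` — `Nrm`-sweep bytes + `n_lo > 0` ⟹ `0 < Re⟨ψ̃,ψ̃⟩` (part 29's
  `norm_window_of_reader` + `re_pos_of_window`, `star_toSpinVec_dotProduct`);
* **`producersSourcedBoxNode_of_reader`** — THE PRODUCTION FRAME: bytes of the `H̃`-sweep over ird-3's
  `quadAutomaton` (weights `dGammaHop (orbPullback e 𝓗^ḡ)`, on-site words `quadOnSite 𝓗^ḡ U μ e`), of the `Ñ`-sweep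
  (`quadAutomaton 0 0 numberOnSite`) and of the `Nrm`-sweep + the by-value ACCEPT test against `e·ab` + the four
  by-value window tests against `n_lo·ab`, `n_hi·ab` + `n_lo > 0` + F-V2 labels ⟹ the five-conjunct claim node;
* **`sourcedBoxNode_of_reader`** — the same in Lieb's frame (`w5Nambu`, `g ≡ 1`).

The parity printed by a row (`HasParity 0` when `Ñ ≡ ab (mod 2)`) follows from `HasParity (Ñ + ab)` by
`HasParity.mono`; nothing else is between the reader's bytes and the row's `@[conjecture]` body.
-/

noncomputable section

open Matrix Finset WithLp
open scoped BigOperators ComplexOrder Matrix.Norms.L2Operator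

namespace Summit.Ventures.CertifiedManyBodySolver.Upper.IntervalReader

open Literature.MathematicalPhysics.QuantumLattice
open Literature.MathematicalPhysics.QuantumLattice.JordanWigner
open Literature.MathematicalPhysics.QuantumLattice.TwoCluster (HasParity)

/-! ## §UU  Lieb's frame is the producers' frame at `g ≡ 1` -/

section Frame

variable {Λ : Type*} [LinearOrder Λ] [Fintype Λ]

/-- **The transformed particle number in Lieb's frame**: `Wᴴ N W = |Λ|·1 + Σ_x (n_{x↑} − n_{x↓})` for
`W = partialParticleHole D↓` (`gaugedShiba'_conjTranspose_conj_totalNumber` at the trivial gauge `g ≡ 1`, where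
`orbitalPhase 1 = 1`). -/
theorem partialParticleHole_conjTranspose_conj_totalNumber :
    (partialParticleHole (spinDownOrbitals : Finset (Orb Λ)))ᴴ * totalNumber *
        partialParticleHole (spinDownOrbitals : Finset (Orb Λ)) =
      (Fintype.card Λ : ℂ) • (1 : Matrix (Finset (Orb Λ)) (Finset (Orb Λ)) ℂ) +
        ∑ x : Λ, (numberOp x 0 - numberOp x 1) := by
  have h1 : orbitalPhase (fun _ : Orb Λ => (1 : ℂ)) = 1 := by
    simp [orbitalPhase]
  have h := gaugedShiba'_conjTranspose_conj_totalNumber (Λ := Λ) (g := fun _ => (1 : ℂ)) (fun _ => by simp)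
  rw [h1, Matrix.mul_one] at h
  exact h

end Frame

/-! ## §VV  V1 and V3 of FORMAT-mpsgf1 from the reader's bytes -/

section Witness

variable {a b D : ℕ}

/-- **V1 — the sector from the labels.**  F-V2 bond-charge labels with right boundary label `Ñ` make
`ψ̃ = toSpinVec⁻¹ Ψ` an `Ñ`-particle vector. -/
theorem transformedWitness_sector_of_reader (e : Fin (a * b) ≃ (Fin a ×ₗ Fin b)) (A : Fin (a * b) → MPSTensor 4 D)
    (l r : Fin D → ℂ) (Nt : ℕ) (c : Fin (a * b + 1) → Fin D → ℕ)
    (hcl : ∀ α, l α ≠ 0 → c 0 α = 0) (hcr : ∀ β, r β ≠ 0 → c (Fin.last (a * b)) β = Nt)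
    (hcA : ∀ (j : Fin (a * b)) (s : Fin 4) (α β : Fin D),
      A j s α β ≠ 0 → c j.succ β = c j.castSucc α + siteCharge s) :
    IsNParticle Nt (toSpinVec.symm
      (fun k : TensorIndex (Fin a ×ₗ Fin b) 4 => mpsOpenVar (a * b) A l r (fun i => k (e i)))) := by
  rw [isNParticle_iff, LinearEquiv.apply_symm_apply]
  exact mpsOpenVar_relabel_eq_zero_of_charge e A l r Nt c hcl hcr hcA

/-- **V3 — the norm is positive.**  The `Nrm`-sweep bytes and the code's assertion `n_lo > 0` give `0 < Re⟨ψ̃,ψ̃⟩`. -/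
theorem transformedWitness_pos_of_reader (e : Fin (a * b) ≃ (Fin a ×ₗ Fin b)) (A : Fin (a * b) → MPSTensor 4 D)
    (l r : Fin D → ℂ) (κ : Fin (a * b) → ℝ) (hκ0 : ∀ k, 0 ≤ κ k)
    (hκ : ∀ k (z : EuclideanSpace ℂ (Fin D)), ∑ s, ‖toLp 2 (A k s *ᵥ ofLp z)‖ ^ 2 ≤ κ k * ‖z‖ ^ 2)
    (YN : Fin (a * b + 1) → Matrix (Fin D) (Fin D) ℂ) (ρN : Fin (a * b) → ℝ)
    (hρN : ∀ k : Fin (a * b), ‖YN k.succ - transferOp (A k) 1 (YN k.castSucc)‖ ≤ ρN k)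
    (radN : Fin (a * b + 1) → ℝ) (hrN0 : ‖YN 0 - vecMulVec (star l) l‖ ≤ radN 0)
    (hrN : ∀ k : Fin (a * b), 1 * κ k * radN k.castSucc + ρN k ≤ radN k.succ)
    (hn : (∑ i, ‖r i‖) * (∑ i, ‖r i‖) * radN (Fin.last (a * b)) < (star r ⬝ᵥ (YN (Fin.last (a * b)) *ᵥ r)).re) :
    0 < (star (toSpinVec.symm
        (fun k : TensorIndex (Fin a ×ₗ Fin b) 4 => mpsOpenVar (a * b) A l r (fun i => k (e i)))) ⬝ᵥ
      toSpinVec.symm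
        (fun k : TensorIndex (Fin a ×ₗ Fin b) 4 => mpsOpenVar (a * b) A l r (fun i => k (e i)))).re := by
  rw [← star_toSpinVec_dotProduct, LinearEquiv.apply_symm_apply]
  exact re_pos_of_window (norm_window_of_reader e A l r κ hκ0 hκ YN ρN hρN radN hrN0 hrN) hn

end Witness

/-! ## §WW  The five-conjunct claim node from the reader's bytes -/

section ClaimNode

variable {a b D : ℕ}

/-- **THE W5 CLAIM NODE, PRODUCERS' FRAME** (real sign gauge `g i = ±1`, e.g. the production `g(r↓) = (−1)^{x+y}`).
Hypotheses: part 22's for the `H̃`-sweep (`Mo …, YH …, radH …`) with the ACCEPT test against `E = e·ab`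
(`hElo`, `hEhi`); part 23's for the `Ñ`-sweep (`Mn …, YD …, radD …`) with the four window tests against
`n_lo·ab`, `n_hi·ab`; the shared `Nrm`-sweep (`YN …, radN …`); the code's assertion `n_lo > 0` (`hn`); the
certificate's F-V2 labels with right label `Ñ`.  Conclusion: the five-conjunct node of
`Upper.sourcedBoxNode_of_gaugedShibaWitness'` (parity `Ñ + ab`). -/
theorem producersSourcedBoxNode_of_reader (U μ h : ℝ) (eQ nlo nhi : ℚ) {g : Orb (Fin a ×ₗ Fin b) → ℂ}
    (hg : ∀ i, g i = 1 ∨ g i = -1) (e : Fin (a * b) ≃ (Fin a ×ₗ Fin b))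
    (he : ∀ i j, e i < e j ↔ i < j) (A : Fin (a * b) → MPSTensor 4 D) (l r : Fin D → ℂ)
    (κ : Fin (a * b) → ℝ) (hκ0 : ∀ k, 0 ≤ κ k)
    (hκ : ∀ k (z : EuclideanSpace ℂ (Fin D)), ∑ s, ‖toLp 2 (A k s *ᵥ ofLp z)‖ ^ 2 ≤ κ k * ‖z‖ ^ 2)
    -- the `H̃`-sweep (part 22, producers' frame)
    (Mo : Fin (a * b) → QState (a * b) → QState (a * b) → ℝ) (hM0 : ∀ k b' c, 0 ≤ Mo k b' c)
    (hMrow : ∀ k b' c s, ∑ s', ‖quadAutomaton (dGammaHop (orbPullback e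
      (Matrix.of fun i j => star (g i) * g j * w5Nambu a b μ h i j))) (fun _ _ _ _ => 0)
      (quadOnSite (Matrix.of fun i j => star (g i) * g j * w5Nambu a b μ h i j) U μ e) k b' c s s'‖ ≤ Mo k b' c)
    (hMcol : ∀ k b' c s', ∑ s, ‖quadAutomaton (dGammaHop (orbPullback e
      (Matrix.of fun i j => star (g i) * g j * w5Nambu a b μ h i j))) (fun _ _ _ _ => 0)
      (quadOnSite (Matrix.of fun i j => star (g i) * g j * w5Nambu a b μ h i j) U μ e) k b' c s s'‖ ≤ Mo k b' c)
    (YH : Fin (a * b + 1) → QState (a * b) → Matrix (Fin D) (Fin D) ℂ) (ρH : Fin (a * b) → QState (a * b) → ℝ)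
    (hρH : ∀ (k : Fin (a * b)) (c : QState (a * b)),
      ‖YH k.succ c - ∑ b', transferOp (A k) (quadAutomaton (dGammaHop (orbPullback e
        (Matrix.of fun i j => star (g i) * g j * w5Nambu a b μ h i j))) (fun _ _ _ _ => 0)
        (quadOnSite (Matrix.of fun i j => star (g i) * g j * w5Nambu a b μ h i j) U μ e) k b' c)
        (YH k.castSucc b')‖ ≤ ρH k c)
    (radH : Fin (a * b + 1) → QState (a * b) → ℝ)
    (hrH0 : ∀ b', ‖YH 0 b' -
      (Pi.single QState.start (vecMulVec (star l) l) : QState (a * b) → Matrix (Fin D) (Fin D) ℂ) b'‖ ≤ radH 0 b')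
    (hrH : ∀ (k : Fin (a * b)) (c : QState (a * b)),
      ∑ b', Mo k b' c * κ k * radH k.castSucc b' + ρH k c ≤ radH k.succ c)
    -- the `Ñ`-sweep (part 23)
    (Mn : Fin (a * b) → QState (a * b) → QState (a * b) → ℝ) (hMn0 : ∀ k b' c, 0 ≤ Mn k b' c)
    (hMnrow : ∀ k b' c s, ∑ s', ‖quadAutomaton (fun _ _ _ _ => 0) (fun _ _ _ _ => 0) (numberOnSite a b) k b' c s s'‖ ≤
      Mn k b' c)
    (hMncol : ∀ k b' c s', ∑ s, ‖quadAutomaton (fun _ _ _ _ => 0) (fun _ _ _ _ => 0) (numberOnSite a b) k b' c s s'‖ ≤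
      Mn k b' c)
    (YD : Fin (a * b + 1) → QState (a * b) → Matrix (Fin D) (Fin D) ℂ) (ρD : Fin (a * b) → QState (a * b) → ℝ)
    (hρD : ∀ (k : Fin (a * b)) (c : QState (a * b)),
      ‖YD k.succ c - ∑ b', transferOp (A k) (quadAutomaton (fun _ _ _ _ => 0) (fun _ _ _ _ => 0) (numberOnSite a b)
        k b' c) (YD k.castSucc b')‖ ≤ ρD k c)
    (radD : Fin (a * b + 1) → QState (a * b) → ℝ)
    (hrD0 : ∀ b', ‖YD 0 b' -
      (Pi.single QState.start (vecMulVec (star l) l) : QState (a * b) → Matrix (Fin D) (Fin D) ℂ) b'‖ ≤ radD 0 b')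
    (hrD : ∀ (k : Fin (a * b)) (c : QState (a * b)),
      ∑ b', Mn k b' c * κ k * radD k.castSucc b' + ρD k c ≤ radD k.succ c)
    -- the `Nrm`-sweep (shared)
    (YN : Fin (a * b + 1) → Matrix (Fin D) (Fin D) ℂ) (ρN : Fin (a * b) → ℝ)
    (hρN : ∀ k : Fin (a * b), ‖YN k.succ - transferOp (A k) 1 (YN k.castSucc)‖ ≤ ρN k)
    (radN : Fin (a * b + 1) → ℝ) (hrN0 : ‖YN 0 - vecMulVec (star l) l‖ ≤ radN 0)
    (hrN : ∀ k : Fin (a * b), 1 * κ k * radN k.castSucc + ρN k ≤ radN k.succ)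
    -- the by-value ACCEPT test of the energy row against `E = e·ab`
    (hElo : (star r ⬝ᵥ (YH (Fin.last (a * b)) QState.fin *ᵥ r)).re +
        (∑ i, ‖r i‖) * (∑ i, ‖r i‖) * radH (Fin.last (a * b)) QState.fin ≤
      ((eQ : ℝ) * ((a : ℝ) * b)) * ((star r ⬝ᵥ (YN (Fin.last (a * b)) *ᵥ r)).re -
        (∑ i, ‖r i‖) * (∑ i, ‖r i‖) * radN (Fin.last (a * b))))
    (hEhi : (star r ⬝ᵥ (YH (Fin.last (a * b)) QState.fin *ᵥ r)).re +
        (∑ i, ‖r i‖) * (∑ i, ‖r i‖) * radH (Fin.last (a * b)) QState.fin ≤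
      ((eQ : ℝ) * ((a : ℝ) * b)) * ((star r ⬝ᵥ (YN (Fin.last (a * b)) *ᵥ r)).re +
        (∑ i, ‖r i‖) * (∑ i, ‖r i‖) * radN (Fin.last (a * b))))
    -- the four by-value window tests of the density rows against `n_lo·ab`, `n_hi·ab`
    (hnlo1 : ((nlo : ℝ) * ((a : ℝ) * b)) * ((star r ⬝ᵥ (YN (Fin.last (a * b)) *ᵥ r)).re -
        (∑ i, ‖r i‖) * (∑ i, ‖r i‖) * radN (Fin.last (a * b))) ≤
      (star r ⬝ᵥ (YD (Fin.last (a * b)) QState.fin *ᵥ r)).re -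
        (∑ i, ‖r i‖) * (∑ i, ‖r i‖) * radD (Fin.last (a * b)) QState.fin)
    (hnlo2 : ((nlo : ℝ) * ((a : ℝ) * b)) * ((star r ⬝ᵥ (YN (Fin.last (a * b)) *ᵥ r)).re +
        (∑ i, ‖r i‖) * (∑ i, ‖r i‖) * radN (Fin.last (a * b))) ≤
      (star r ⬝ᵥ (YD (Fin.last (a * b)) QState.fin *ᵥ r)).re -
        (∑ i, ‖r i‖) * (∑ i, ‖r i‖) * radD (Fin.last (a * b)) QState.fin)
    (hnhi1 : (star r ⬝ᵥ (YD (Fin.last (a * b)) QState.fin *ᵥ r)).re +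
        (∑ i, ‖r i‖) * (∑ i, ‖r i‖) * radD (Fin.last (a * b)) QState.fin ≤
      ((nhi : ℝ) * ((a : ℝ) * b)) * ((star r ⬝ᵥ (YN (Fin.last (a * b)) *ᵥ r)).re -
        (∑ i, ‖r i‖) * (∑ i, ‖r i‖) * radN (Fin.last (a * b))))
    (hnhi2 : (star r ⬝ᵥ (YD (Fin.last (a * b)) QState.fin *ᵥ r)).re +
        (∑ i, ‖r i‖) * (∑ i, ‖r i‖) * radD (Fin.last (a * b)) QState.fin ≤
      ((nhi : ℝ) * ((a : ℝ) * b)) * ((star r ⬝ᵥ (YN (Fin.last (a * b)) *ᵥ r)).re +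
        (∑ i, ‖r i‖) * (∑ i, ‖r i‖) * radN (Fin.last (a * b))))
    -- the code's assertion `n_lo > 0` (h1sweep.py l.398)
    (hn : (∑ i, ‖r i‖) * (∑ i, ‖r i‖) * radN (Fin.last (a * b)) < (star r ⬝ᵥ (YN (Fin.last (a * b)) *ᵥ r)).re)
    -- the certificate's F-V2 bond-charge labels (FORMAT-mpsgf1 §2 V1: transformed particle number `Ñ`)
    (Nt : ℕ) (c : Fin (a * b + 1) → Fin D → ℕ)
    (hcl : ∀ α, l α ≠ 0 → c 0 α = 0) (hcr : ∀ β, r β ≠ 0 → c (Fin.last (a * b)) β = Nt)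
    (hcA : ∀ (j : Fin (a * b)) (s : Fin 4) (α β : Fin D),
      A j s α β ≠ 0 → c j.succ β = c j.castSucc α + siteCharge s) :
    ∃ ψ : Fock (Orb (Fin a ×ₗ Fin b)), HasParity (Nt + a * b) ψ ∧ star ψ ⬝ᵥ ψ = 1 ∧
      (star ψ ⬝ᵥ (dWaveSourceOpenBox a b U μ h *ᵥ ψ)).re ≤ ((eQ : ℚ) : ℝ) * ((a : ℝ) * b) ∧
      ((nlo : ℚ) : ℝ) * ((a : ℝ) * b) ≤ (star ψ ⬝ᵥ (totalNumber *ᵥ ψ)).re ∧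
      (star ψ ⬝ᵥ (totalNumber *ᵥ ψ)).re ≤ ((nhi : ℚ) : ℝ) * ((a : ℝ) * b) := by
  have hg' : ∀ i, ‖g i‖ = 1 := fun i => by rcases hg i with h1 | h1 <;> simp [h1]
  -- the energy row (part 22, producers' frame)
  have hE := producersSourcedBox_sentence_of_reader U μ h hg e he A l r κ hκ0 hκ Mo hM0 hMrow hMcol YH ρH hρH radH
    hrH0 hrH YN ρN hρN radN hrN0 hrN ((eQ : ℝ) * ((a : ℝ) * b)) hElo hEhi
  -- the density window (part 23), moved into the producers' frame
  have hDW := densityWindow_of_reader e A l r κ hκ0 hκ Mn hMn0 hMnrow hMncol YD ρD hρD radD hrD0 hrD YN ρN hρN radN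
    hrN0 hrN ((nlo : ℝ) * ((a : ℝ) * b)) ((nhi : ℝ) * ((a : ℝ) * b)) hnlo1 hnlo2 hnhi1 hnhi2
  rw [← gaugedShiba'_conjTranspose_conj_totalNumber hg'] at hDW
  -- V1 and V3
  have hN := transformedWitness_sector_of_reader e A l r Nt c hcl hcr hcA
  have hpos := transformedWitness_pos_of_reader e A l r κ hκ0 hκ YN ρN hρN radN hrN0 hrN hn
  exact sourcedBoxNode_of_gaugedShibaWitness' a b U μ h eQ nlo nhi hg' _ hN hpos hE hDW.1 hDW.2

/-- **THE W5 CLAIM NODE, LIEB'S FRAME** (`W = partialParticleHole D↓`, the frame of part 11 and of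
`Upper.sourcedBoxNode_of_transformedWitness`; the producers' frame at `g ≡ 1`).  Same hypotheses with the
`H̃`-sweep over the automaton of `w5Nambu a b μ h` itself. -/
theorem sourcedBoxNode_of_reader (U μ h : ℝ) (eQ nlo nhi : ℚ) (e : Fin (a * b) ≃ (Fin a ×ₗ Fin b))
    (he : ∀ i j, e i < e j ↔ i < j) (A : Fin (a * b) → MPSTensor 4 D) (l r : Fin D → ℂ)
    (κ : Fin (a * b) → ℝ) (hκ0 : ∀ k, 0 ≤ κ k)
    (hκ : ∀ k (z : EuclideanSpace ℂ (Fin D)), ∑ s, ‖toLp 2 (A k s *ᵥ ofLp z)‖ ^ 2 ≤ κ k * ‖z‖ ^ 2)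
    -- the `H̃`-sweep (part 22, Lieb frame)
    (Mo : Fin (a * b) → QState (a * b) → QState (a * b) → ℝ) (hM0 : ∀ k b' c, 0 ≤ Mo k b' c)
    (hMrow : ∀ k b' c s, ∑ s', ‖quadAutomaton (dGammaHop (orbPullback e (w5Nambu a b μ h))) (fun _ _ _ _ => 0)
      (quadOnSite (w5Nambu a b μ h) U μ e) k b' c s s'‖ ≤ Mo k b' c)
    (hMcol : ∀ k b' c s', ∑ s, ‖quadAutomaton (dGammaHop (orbPullback e (w5Nambu a b μ h))) (fun _ _ _ _ => 0)
      (quadOnSite (w5Nambu a b μ h) U μ e) k b' c s s'‖ ≤ Mo k b' c)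
    (YH : Fin (a * b + 1) → QState (a * b) → Matrix (Fin D) (Fin D) ℂ) (ρH : Fin (a * b) → QState (a * b) → ℝ)
    (hρH : ∀ (k : Fin (a * b)) (c : QState (a * b)),
      ‖YH k.succ c - ∑ b', transferOp (A k) (quadAutomaton (dGammaHop (orbPullback e (w5Nambu a b μ h)))
        (fun _ _ _ _ => 0) (quadOnSite (w5Nambu a b μ h) U μ e) k b' c) (YH k.castSucc b')‖ ≤ ρH k c)
    (radH : Fin (a * b + 1) → QState (a * b) → ℝ)
    (hrH0 : ∀ b', ‖YH 0 b' -
      (Pi.single QState.start (vecMulVec (star l) l) : QState (a * b) → Matrix (Fin D) (Fin D) ℂ) b'‖ ≤ radH 0 b')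
    (hrH : ∀ (k : Fin (a * b)) (c : QState (a * b)),
      ∑ b', Mo k b' c * κ k * radH k.castSucc b' + ρH k c ≤ radH k.succ c)
    -- the `Ñ`-sweep (part 23)
    (Mn : Fin (a * b) → QState (a * b) → QState (a * b) → ℝ) (hMn0 : ∀ k b' c, 0 ≤ Mn k b' c)
    (hMnrow : ∀ k b' c s, ∑ s', ‖quadAutomaton (fun _ _ _ _ => 0) (fun _ _ _ _ => 0) (numberOnSite a b) k b' c s s'‖ ≤
      Mn k b' c)
    (hMncol : ∀ k b' c s', ∑ s, ‖quadAutomaton (fun _ _ _ _ => 0) (fun _ _ _ _ => 0) (numberOnSite a b) k b' c s s'‖ ≤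
      Mn k b' c)
    (YD : Fin (a * b + 1) → QState (a * b) → Matrix (Fin D) (Fin D) ℂ) (ρD : Fin (a * b) → QState (a * b) → ℝ)
    (hρD : ∀ (k : Fin (a * b)) (c : QState (a * b)),
      ‖YD k.succ c - ∑ b', transferOp (A k) (quadAutomaton (fun _ _ _ _ => 0) (fun _ _ _ _ => 0) (numberOnSite a b)
        k b' c) (YD k.castSucc b')‖ ≤ ρD k c)
    (radD : Fin (a * b + 1) → QState (a * b) → ℝ)
    (hrD0 : ∀ b', ‖YD 0 b' -
      (Pi.single QState.start (vecMulVec (star l) l) : QState (a * b) → Matrix (Fin D) (Fin D) ℂ) b'‖ ≤ radD 0 b')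
    (hrD : ∀ (k : Fin (a * b)) (c : QState (a * b)),
      ∑ b', Mn k b' c * κ k * radD k.castSucc b' + ρD k c ≤ radD k.succ c)
    -- the `Nrm`-sweep (shared)
    (YN : Fin (a * b + 1) → Matrix (Fin D) (Fin D) ℂ) (ρN : Fin (a * b) → ℝ)
    (hρN : ∀ k : Fin (a * b), ‖YN k.succ - transferOp (A k) 1 (YN k.castSucc)‖ ≤ ρN k)
    (radN : Fin (a * b + 1) → ℝ) (hrN0 : ‖YN 0 - vecMulVec (star l) l‖ ≤ radN 0)
    (hrN : ∀ k : Fin (a * b), 1 * κ k * radN k.castSucc + ρN k ≤ radN k.succ)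
    -- by-value tests
    (hElo : (star r ⬝ᵥ (YH (Fin.last (a * b)) QState.fin *ᵥ r)).re +
        (∑ i, ‖r i‖) * (∑ i, ‖r i‖) * radH (Fin.last (a * b)) QState.fin ≤
      ((eQ : ℝ) * ((a : ℝ) * b)) * ((star r ⬝ᵥ (YN (Fin.last (a * b)) *ᵥ r)).re -
        (∑ i, ‖r i‖) * (∑ i, ‖r i‖) * radN (Fin.last (a * b))))
    (hEhi : (star r ⬝ᵥ (YH (Fin.last (a * b)) QState.fin *ᵥ r)).re +
        (∑ i, ‖r i‖) * (∑ i, ‖r i‖) * radH (Fin.last (a * b)) QState.fin ≤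
      ((eQ : ℝ) * ((a : ℝ) * b)) * ((star r ⬝ᵥ (YN (Fin.last (a * b)) *ᵥ r)).re +
        (∑ i, ‖r i‖) * (∑ i, ‖r i‖) * radN (Fin.last (a * b))))
    (hnlo1 : ((nlo : ℝ) * ((a : ℝ) * b)) * ((star r ⬝ᵥ (YN (Fin.last (a * b)) *ᵥ r)).re -
        (∑ i, ‖r i‖) * (∑ i, ‖r i‖) * radN (Fin.last (a * b))) ≤
      (star r ⬝ᵥ (YD (Fin.last (a * b)) QState.fin *ᵥ r)).re -
        (∑ i, ‖r i‖) * (∑ i, ‖r i‖) * radD (Fin.last (a * b)) QState.fin)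
    (hnlo2 : ((nlo : ℝ) * ((a : ℝ) * b)) * ((star r ⬝ᵥ (YN (Fin.last (a * b)) *ᵥ r)).re +
        (∑ i, ‖r i‖) * (∑ i, ‖r i‖) * radN (Fin.last (a * b))) ≤
      (star r ⬝ᵥ (YD (Fin.last (a * b)) QState.fin *ᵥ r)).re -
        (∑ i, ‖r i‖) * (∑ i, ‖r i‖) * radD (Fin.last (a * b)) QState.fin)
    (hnhi1 : (star r ⬝ᵥ (YD (Fin.last (a * b)) QState.fin *ᵥ r)).re +
        (∑ i, ‖r i‖) * (∑ i, ‖r i‖) * radD (Fin.last (a * b)) QState.fin ≤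
      ((nhi : ℝ) * ((a : ℝ) * b)) * ((star r ⬝ᵥ (YN (Fin.last (a * b)) *ᵥ r)).re -
        (∑ i, ‖r i‖) * (∑ i, ‖r i‖) * radN (Fin.last (a * b))))
    (hnhi2 : (star r ⬝ᵥ (YD (Fin.last (a * b)) QState.fin *ᵥ r)).re +
        (∑ i, ‖r i‖) * (∑ i, ‖r i‖) * radD (Fin.last (a * b)) QState.fin ≤
      ((nhi : ℝ) * ((a : ℝ) * b)) * ((star r ⬝ᵥ (YN (Fin.last (a * b)) *ᵥ r)).re +
        (∑ i, ‖r i‖) * (∑ i, ‖r i‖) * radN (Fin.last (a * b))))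
    (hn : (∑ i, ‖r i‖) * (∑ i, ‖r i‖) * radN (Fin.last (a * b)) < (star r ⬝ᵥ (YN (Fin.last (a * b)) *ᵥ r)).re)
    (Nt : ℕ) (c : Fin (a * b + 1) → Fin D → ℕ)
    (hcl : ∀ α, l α ≠ 0 → c 0 α = 0) (hcr : ∀ β, r β ≠ 0 → c (Fin.last (a * b)) β = Nt)
    (hcA : ∀ (j : Fin (a * b)) (s : Fin 4) (α β : Fin D),
      A j s α β ≠ 0 → c j.succ β = c j.castSucc α + siteCharge s) :
    ∃ ψ : Fock (Orb (Fin a ×ₗ Fin b)), HasParity (Nt + a * b) ψ ∧ star ψ ⬝ᵥ ψ = 1 ∧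
      (star ψ ⬝ᵥ (dWaveSourceOpenBox a b U μ h *ᵥ ψ)).re ≤ ((eQ : ℚ) : ℝ) * ((a : ℝ) * b) ∧
      ((nlo : ℚ) : ℝ) * ((a : ℝ) * b) ≤ (star ψ ⬝ᵥ (totalNumber *ᵥ ψ)).re ∧
      (star ψ ⬝ᵥ (totalNumber *ᵥ ψ)).re ≤ ((nhi : ℚ) : ℝ) * ((a : ℝ) * b) := by
  -- the energy row (part 22, Lieb frame)
  have hE := sourcedBox_sentence_of_reader U μ h e he A l r κ hκ0 hκ Mo hM0 hMrow hMcol YH ρH hρH radH hrH0 hrH YN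
    ρN hρN radN hrN0 hrN ((eQ : ℝ) * ((a : ℝ) * b)) hElo hEhi
  -- the density window (part 23), moved into Lieb's frame
  have hDW := densityWindow_of_reader e A l r κ hκ0 hκ Mn hMn0 hMnrow hMncol YD ρD hρD radD hrD0 hrD YN ρN hρN radN
    hrN0 hrN ((nlo : ℝ) * ((a : ℝ) * b)) ((nhi : ℝ) * ((a : ℝ) * b)) hnlo1 hnlo2 hnhi1 hnhi2
  rw [← partialParticleHole_conjTranspose_conj_totalNumber] at hDW
  -- V1 and V3
  have hN := transformedWitness_sector_of_reader e A l r Nt c hcl hcr hcA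
  have hpos := transformedWitness_pos_of_reader e A l r κ hκ0 hκ YN ρN hρN radN hrN0 hrN hn
  exact sourcedBoxNode_of_transformedWitness a b U μ h eQ nlo nhi _ hN hpos hE hDW.1 hDW.2

end ClaimNode

end Summit.Ventures.CertifiedManyBodySolver.Upper.IntervalReader

end
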